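import Summits.Schanuel.Schanuel.Theorems.RootDecomp1KHyper20

/-!
# RootDecomp1KHyper — lens 6, generation 15 «QUAD-ANCHORED CELL» (QuadAnchor.lean 33b3769e…, 2400 l) — continuation (RootDecomp1KHyper21): §3 THE ENGINE `no_int_relation_of_mvWeakMeasure_hyperQuad` (weakly measured tuples are algebraically free from hyper-quadratic reals)

(lens-6 g15 `QuadAnchor.lean`, sha256 33b3769e…6b415, farm rc 0 · 0 sorry · axioms standard; port by census-1 gen 14 in eight parts RootDecomp1KHyper20–27 at the section
cuts of CENSUS-REQUEST 2026-08-31T01:16:56Z (STATUS L1528; §5 cut at §5b; §3's three engine corollaries moved to where they are first used); each part imports the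
previous; statements and proofs verbatim (54 one-line docstrings added, six generic one-liners privatised with per-part private copies, the two `linter.*` options dropped, two unused binders renamed `_`); `hLW : LWMeasure` (tree-proved
named fact) stays a binder where marked; `--supports stmt-Schanuel-33363` (A₄ʰ HyperLiouvilleSchanuel, residual of record `Rank3SpanResidual`). Nothing here proves Schanuel; rung 0.)
-/

noncomputable section

open Complex IntermediateField Polynomial

namespace Summit.Schanuel.Schanuel.Theorems.RootDecomp1KHyper

namespace HyperCell
variable {n : ℕ}
open Summit.Schanuel.Schanuel.Theorems.RootDecomp1KGeneric (HasHLPairInSpan Rank3SpanResidual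
  mem_adjoin_of_mem_span cexp_mem_adjoin_of_mem_span)

/-! ## 3. THE ENGINE: weakly measured tuples are algebraically free from hyper-quadratic reals -/

/-- `exp(−x) ≤ 1/x` for `x > 0`. -/
private theorem exp_neg_le_one_div' {x : ℝ} (hx : 0 < x) : Real.exp (-x) ≤ 1 / x := by
  rw [Real.exp_neg, ← one_div]
  exact one_div_le_one_div_of_le hx (by linarith [Real.add_one_le_exp x])

set_option maxHeartbeats 1000000 in
/-- **Hyper-quadratic extraction in several variables (kernel).**  No relation
`Σ_{k ≤ K} G_k(θ) y^k = 0`, `G_k ∈ ℤ[X₁, …, Xₙ]` not all zero, between a tuple `θ` with an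
`MvWeakMeasure` and a real `y` hyper-approximable from the real quadratic field `ℚ(√D)`, `√D ∉ ℚ`.
Proof: specialise the relation at an approximant `β = (a + b√D)/q` and multiply by the CONJUGATE
specialisation at `β' = (a − b√D)/q`: the product `q^{2K} μ(β) μ(β')` is the value at `θ` of the integer
polynomial `𝒜² − D·ℬ²` (`𝒜 + √D ℬ = q^K μ(β)` coefficientwise), which is non-zero because `√D ∉ ℚ`
and `μ(β) ≠ 0` (punctured ball), has length polynomial in `1 + q + |a| + |b|`, and is smaller than the
measure allows. -/
theorem no_int_relation_of_mvWeakMeasure_hyperQuad {n : ℕ} {θ : Fin n → ℂ}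
    (hθ : MvWeakMeasure θ) {D : ℕ} (hD : Irrational (Real.sqrt D)) {y : ℝ}
    (hy : HyperQuadApprox D y) {K : ℕ}
    (G : Fin (K + 1) → MvPolynomial (Fin n) ℤ) (hG : ∃ k, G k ≠ 0)
    (hrel : ∑ k : Fin (K + 1), MvPolynomial.aeval θ (G k) * (y : ℂ) ^ (k : ℕ) = 0) : False := by
  classical
  -- the complex polynomial μ(Y) = Σ_k G_k(θ) Y^k
  set μ : ℂ[X] := ∑ k : Fin (K + 1), C (MvPolynomial.aeval θ (G k)) * X ^ (k : ℕ) with hμdef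
  have hμeval : ∀ w : ℂ, μ.eval w =
      ∑ k : Fin (K + 1), MvPolynomial.aeval θ (G k) * w ^ (k : ℕ) := by
    intro w
    simp only [hμdef, eval_finsetSum, eval_mul, eval_C, eval_pow, eval_X]
  have hμcoeff : ∀ k : Fin (K + 1), μ.coeff k = MvPolynomial.aeval θ (G k) := by
    intro k
    simp only [hμdef, finsetSum_coeff, coeff_C_mul, coeff_X_pow]
    rw [Finset.sum_eq_single k]
    · simp
    · intro j _ hjk
      have : (k : ℕ) ≠ (j : ℕ) := fun h => hjk (Fin.ext h).symm
      simp [this]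
    · intro h; exact absurd (Finset.mem_univ k) h
  have hμ0 : μ ≠ 0 := by
    obtain ⟨k, hk⟩ := hG
    intro h0
    have h1 : μ.coeff k = 0 := by rw [h0, coeff_zero]
    rw [hμcoeff] at h1
    exact mvaeval_ne_zero_of_mvWeakMeasure hθ hk h1
  have hroot : μ.eval (y : ℂ) = 0 := by rw [hμeval]; exact hrel
  obtain ⟨δ, hδ, hδroot⟩ := exists_ball_eval_ne_zero μ hμ0 y
  obtain ⟨L, hL, hLip⟩ := exists_lipschitz_at_root μ y hroot
  -- degrees, the measure, products of pairs
  set Dg : ℕ := Finset.univ.sup fun k : Fin (K + 1) => (G k).totalDegree with hDgdef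
  have hDg : ∀ k, (G k).totalDegree ≤ Dg := fun k =>
    Finset.le_sup (f := fun k : Fin (K + 1) => (G k).totalDegree) (Finset.mem_univ k)
  obtain ⟨Cm, kk, hCm, hmeas⟩ := hθ (Dg + Dg)
  set GG : Fin (K + 1) × Fin (K + 1) → MvPolynomial (Fin n) ℤ := fun jk => G jk.1 * G jk.2
    with hGGdef
  have hGGdeg : ∀ jk, (GG jk).totalDegree ≤ Dg + Dg := fun jk =>
    (MvPolynomial.totalDegree_mul _ _).trans (add_le_add (hDg _) (hDg _))
  set Λ₂ : ℤ := ∑ jk, mvlen (GG jk) with hΛ₂def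
  have hΛ₂ : 0 ≤ Λ₂ := Finset.sum_nonneg fun _ _ => mvlen_nonneg _
  have hΛ₂R : (0 : ℝ) ≤ ((Λ₂ : ℤ) : ℝ) := by exact_mod_cast hΛ₂
  set Gs : ℝ := ∑ k : Fin (K + 1), ‖MvPolynomial.aeval θ (G k)‖ with hGsdef
  have hGs : 0 ≤ Gs := Finset.sum_nonneg fun _ _ => norm_nonneg _
  -- constants
  have hD0 : (0 : ℝ) ≤ (D : ℝ) := Nat.cast_nonneg D
  set E : ℝ := 1 + (D : ℝ) with hEdef
  have hE1 : 1 ≤ E := by rw [hEdef]; linarith only [hD0]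
  have hE0 : 0 ≤ E := by linarith only [hE1]
  set sD : ℝ := Real.sqrt D with hsDdef
  have hsD0 : 0 ≤ sD := Real.sqrt_nonneg _
  have hsDsq : sD ^ 2 = D := Real.sq_sqrt hD0
  have hωC : ((sD : ℝ) : ℂ) ^ 2 = ((D : ℤ) : ℂ) := by
    rw [Int.cast_natCast]; exact_mod_cast hsDsq
  have hωC' : (-((sD : ℝ) : ℂ)) ^ 2 = ((D : ℤ) : ℂ) := by rw [neg_sq]; exact hωC
  set c₁ : ℝ := Cm * (E ^ (2 * K + 1) * ((Λ₂ : ℤ) : ℝ)) ^ kk with hc₁def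
  set c₂ : ℝ := L * Gs * (1 + sD) ^ K with hc₂def
  have hc₁ : 0 ≤ c₁ := by positivity
  have hc₂ : 0 ≤ c₂ := by positivity
  set e₁ : ℕ := 4 * K * kk with he₁
  set e₂ : ℕ := 3 * K with he₂
  set N : ℕ := ⌈c₁ + c₂ + δ⁻¹⌉₊ + 1 with hNdef
  set m : ℕ := e₁ + e₂ + N with hmdef
  have hδinv : 0 < δ⁻¹ := inv_pos.mpr hδ
  have hNgt : c₁ + c₂ + δ⁻¹ < N := by
    have h1 : c₁ + c₂ + δ⁻¹ ≤ ⌈c₁ + c₂ + δ⁻¹⌉₊ := Nat.le_ceil _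
    rw [hNdef]; push_cast; linarith only [h1]
  have hN2 : (N : ℝ) ≤ (2 : ℝ) ^ N := by
    have h := (Nat.lt_two_pow_self (n := N)).le
    have h' : ((N : ℕ) : ℝ) ≤ ((2 ^ N : ℕ) : ℝ) := Nat.cast_le.mpr h
    simpa using h' 
  -- the approximation
  obtain ⟨a, b, q, hq, hne, hlt⟩ := hy m
  have hq1 : (1 : ℝ) ≤ q := by exact_mod_cast hq
  have hqpos : (0 : ℝ) < q := by exact_mod_cast hq
  have hq0 : q ≠ 0 := by omega
  have hqC : (q : ℂ) ≠ 0 := by exact_mod_cast hq0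
  set Xr : ℝ := 1 + (q : ℝ) + |(a : ℝ)| + |(b : ℝ)| with hXdef
  have hX2 : 2 ≤ Xr := by
    rw [hXdef]; linarith only [hq1, abs_nonneg (a : ℝ), abs_nonneg (b : ℝ)]
  have hX1 : 1 ≤ Xr := by linarith only [hX2]
  have hX0 : 0 < Xr := by linarith only [hX2]
  have hqX : (q : ℝ) ≤ Xr := by
    rw [hXdef]; linarith only [abs_nonneg (a : ℝ), abs_nonneg (b : ℝ)]
  have habX : 1 + |(a : ℝ)| + |(b : ℝ)| ≤ Xr := by rw [hXdef]; linarith only [hqpos]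
  set β : ℝ := ((a : ℝ) + b * sD) / q with hβdef
  set β' : ℝ := ((a : ℝ) - b * sD) / q with hβ'def
  set ε : ℝ := Real.exp (-(Xr ^ m)) with hεdef
  have hε0 : 0 < ε := Real.exp_pos _
  have hXe : ∀ e : ℕ, 1 ≤ Xr ^ e := fun e => one_le_pow₀ hX1
  have hXm : Xr ^ m = Xr ^ N * Xr ^ e₁ * Xr ^ e₂ := by rw [hmdef, pow_add, pow_add]; ring
  have hXN : (N : ℝ) ≤ Xr ^ N := hN2.trans (pow_le_pow_left₀ (by norm_num) hX2 N)
  have hXm_gt : δ⁻¹ < Xr ^ m := by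
    have h1 : Xr ^ N ≤ Xr ^ m := by
      rw [hXm]
      calc Xr ^ N = Xr ^ N * 1 * 1 := by ring
        _ ≤ Xr ^ N * Xr ^ e₁ * Xr ^ e₂ := by gcongr <;> exact hXe _
    linarith only [h1, hXN, hNgt, hc₁, hc₂]
  have hεδ : ε < δ := by
    calc ε < Real.exp (-δ⁻¹) := Real.exp_lt_exp.mpr (by linarith only [hXm_gt])
      _ ≤ 1 / δ⁻¹ := exp_neg_le_one_div' hδinv
      _ = δ := by rw [one_div, inv_inv]
  have hε1 : ε ≤ 1 := by
    rw [hεdef]; exact Real.exp_le_one_iff.mpr (by linarith only [hXe m])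
  have hyβ : |β - y| < ε := by rw [abs_sub_comm]; exact hlt
  have hyβ1 : |β - y| ≤ 1 := by linarith only [hyβ, hε1]
  have hyβδ : |β - y| < δ := by linarith only [hyβ, hεδ]
  have hβne : β ≠ y := fun h => hne h.symm
  -- (1) μ(β) ≠ 0 and the Lipschitz bound
  have hμβ : μ.eval (β : ℂ) ≠ 0 := hδroot β hβne hyβδ
  have hμβle : ‖μ.eval (β : ℂ)‖ ≤ L * ε :=
    (hLip β hyβ1).trans (mul_le_mul_of_nonneg_left hyβ.le hL.le)
  -- (2) the integer polynomials 𝒜, ℬ and P = 𝒜² − D ℬ²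
  set α : Fin (K + 1) → ℤ := fun k => (qpow D a b k).1 * (q : ℤ) ^ (K - k) with hαdef
  set γ : Fin (K + 1) → ℤ := fun k => (qpow D a b k).2 * (q : ℤ) ^ (K - k) with hγdef
  set 𝒜 : MvPolynomial (Fin n) ℤ := mvcombo α G with h𝒜def
  set ℬ : MvPolynomial (Fin n) ℤ := mvcombo γ G with hℬdef
  set P : MvPolynomial (Fin n) ℤ := 𝒜 * 𝒜 - MvPolynomial.C (D : ℤ) * (ℬ * ℬ) with hPdef
  have hβC : ((β : ℝ) : ℂ) = ((a : ℂ) + (b : ℂ) * ((sD : ℝ) : ℂ)) / (q : ℂ) := by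
    rw [hβdef]; push_cast; ring
  have hβ'C : ((β' : ℝ) : ℂ) = ((a : ℂ) + (b : ℂ) * (-((sD : ℝ) : ℂ))) / (q : ℂ) := by
    rw [hβ'def]; push_cast; ring
  have hsplit : ∀ k : Fin (K + 1), (q : ℂ) ^ K = (q : ℂ) ^ (k : ℕ) * (q : ℂ) ^ (K - k) := by
    intro k
    rw [← pow_add, Nat.add_sub_of_le (Nat.lt_succ_iff.mp k.2)]
  have hqinv : ∀ k : Fin (K + 1), (q : ℂ) ^ (k : ℕ) * ((q : ℂ) ^ (k : ℕ))⁻¹ = 1 := fun k =>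
    mul_inv_cancel₀ (pow_ne_zero _ hqC)
  have hAe : MvPolynomial.aeval θ 𝒜 + ((sD : ℝ) : ℂ) * MvPolynomial.aeval θ ℬ =
      (q : ℂ) ^ K * μ.eval (β : ℂ) := by
    rw [h𝒜def, hℬdef, aeval_mvcombo, aeval_mvcombo, hμeval, Finset.mul_sum, Finset.mul_sum,
      ← Finset.sum_add_distrib]
    refine Finset.sum_congr rfl fun k _ => ?_
    have hpow := qpow_spec (R := ℂ) D a b hωC k
    calc ((α k : ℤ) : ℂ) * MvPolynomial.aeval θ (G k) +
          ((sD : ℝ) : ℂ) * (((γ k : ℤ) : ℂ) * MvPolynomial.aeval θ (G k))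
        = (q : ℂ) ^ (K - k) * MvPolynomial.aeval θ (G k) *
            ((((qpow D a b k).1 : ℤ) : ℂ) + (((qpow D a b k).2 : ℤ) : ℂ) * ((sD : ℝ) : ℂ)) := by
          simp only [hαdef, hγdef]; push_cast; ring
      _ = (q : ℂ) ^ (K - k) * MvPolynomial.aeval θ (G k) *
            (((a : ℂ) + (b : ℂ) * ((sD : ℝ) : ℂ)) ^ (k : ℕ)) := by rw [hpow]
      _ = (q : ℂ) ^ K * (MvPolynomial.aeval θ (G k) * ((β : ℝ) : ℂ) ^ (k : ℕ)) := by
          rw [hβC, div_pow, hsplit k, div_eq_mul_inv]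
          linear_combination (-((q : ℂ) ^ (K - k) * MvPolynomial.aeval θ (G k) *
            ((a : ℂ) + (b : ℂ) * ((sD : ℝ) : ℂ)) ^ (k : ℕ))) * hqinv k
  have hBe : MvPolynomial.aeval θ 𝒜 - ((sD : ℝ) : ℂ) * MvPolynomial.aeval θ ℬ =
      (q : ℂ) ^ K * μ.eval (β' : ℂ) := by
    rw [h𝒜def, hℬdef, aeval_mvcombo, aeval_mvcombo, hμeval, Finset.mul_sum, Finset.mul_sum,
      ← Finset.sum_sub_distrib]
    refine Finset.sum_congr rfl fun k _ => ?_
    have hpow := qpow_spec (R := ℂ) D a b hωC' k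
    calc ((α k : ℤ) : ℂ) * MvPolynomial.aeval θ (G k) -
          ((sD : ℝ) : ℂ) * (((γ k : ℤ) : ℂ) * MvPolynomial.aeval θ (G k))
        = (q : ℂ) ^ (K - k) * MvPolynomial.aeval θ (G k) *
            ((((qpow D a b k).1 : ℤ) : ℂ) + (((qpow D a b k).2 : ℤ) : ℂ) * (-((sD : ℝ) : ℂ))) := by
          simp only [hαdef, hγdef]; push_cast; ring
      _ = (q : ℂ) ^ (K - k) * MvPolynomial.aeval θ (G k) *
            (((a : ℂ) + (b : ℂ) * (-((sD : ℝ) : ℂ))) ^ (k : ℕ)) := by rw [hpow]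
      _ = (q : ℂ) ^ K * (MvPolynomial.aeval θ (G k) * ((β' : ℝ) : ℂ) ^ (k : ℕ)) := by
          rw [hβ'C, div_pow, hsplit k, div_eq_mul_inv]
          linear_combination (-((q : ℂ) ^ (K - k) * MvPolynomial.aeval θ (G k) *
            ((a : ℂ) + (b : ℂ) * (-((sD : ℝ) : ℂ))) ^ (k : ℕ))) * hqinv k
  have hPe : MvPolynomial.aeval θ P =
      (q : ℂ) ^ K * μ.eval (β : ℂ) * ((q : ℂ) ^ K * μ.eval (β' : ℂ)) := by
    rw [hPdef, map_sub, map_mul, map_mul, map_mul, MvPolynomial.aeval_C, algebraMap_int_eq,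
      eq_intCast, ← hAe, ← hBe]
    have h2 : ((sD : ℝ) : ℂ) * ((sD : ℝ) : ℂ) = ((D : ℤ) : ℂ) := by rw [← sq]; exact hωC
    rw [← h2]
    ring
  -- (3) P ≠ 0
  have hP0 : P ≠ 0 := by
    intro h0
    have hAB : 𝒜 * 𝒜 = MvPolynomial.C (D : ℤ) * (ℬ * ℬ) := sub_eq_zero.mp (by rw [← hPdef, h0])
    by_cases hB : ℬ = 0
    · have hA : 𝒜 = 0 := by
        rw [hB, mul_zero, mul_zero] at hAB
        exact mul_self_eq_zero.mp hAB
      have h1 : (q : ℂ) ^ K * μ.eval (β : ℂ) = 0 := by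
        rw [← hAe, hA, hB, map_zero, mul_zero, add_zero]
      rcases mul_eq_zero.mp h1 with h | h
      · exact pow_ne_zero K hqC h
      · exact hμβ h
    · obtain ⟨x, hx⟩ : ∃ x : Fin n → ℤ, MvPolynomial.eval x ℬ ≠ 0 := by
        by_contra hall
        push Not at hall
        exact hB (MvPolynomial.funext fun x => by rw [hall x, map_zero])
      set u : ℤ := MvPolynomial.eval x 𝒜 with hu
      set v : ℤ := MvPolynomial.eval x ℬ with hv
      have hsq : u * u = (D : ℤ) * (v * v) := by
        have := congr_arg (MvPolynomial.eval x) hAB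
        simpa [MvPolynomial.eval_C, hu, hv] using this
      have hvR : (v : ℝ) ≠ 0 := by exact_mod_cast hx
      have hsqR : ((u : ℝ)) ^ 2 = (D : ℝ) * (v : ℝ) ^ 2 := by
        rw [sq, sq]; exact_mod_cast hsq
      have hDsq : ((u : ℝ) / v) ^ 2 = (D : ℝ) := by
        rw [div_pow, hsqR]; field_simp
      have hreal : sD = |(u : ℝ) / v| := by
        rw [hsDdef, ← hDsq, Real.sqrt_sq_eq_abs]
      exact hD ⟨|(u : ℚ) / v|, by exact_mod_cast hreal.symm⟩
  -- (4) upper bound ‖P(θ)‖ ≤ c₂ X^{3K} ε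
  have hβ'le : |β'| ≤ (1 + sD) * Xr := by
    rw [hβ'def, abs_div, abs_of_pos hqpos, div_le_iff₀ hqpos]
    have h1 : |(a : ℝ) - b * sD| ≤ |(a : ℝ)| + |(b : ℝ)| * sD := by
      calc |(a : ℝ) - b * sD| ≤ |(a : ℝ)| + |(b : ℝ) * sD| := abs_sub _ _
        _ = |(a : ℝ)| + |(b : ℝ)| * sD := by rw [abs_mul, abs_of_nonneg hsD0]
    have h2 : |(a : ℝ)| + |(b : ℝ)| * sD ≤ (1 + sD) * Xr := by
      have hbX : |(b : ℝ)| ≤ Xr := by linarith only [habX, abs_nonneg (a : ℝ)]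
      have h4 := mul_le_mul_of_nonneg_right hbX hsD0
      linarith only [h4, habX, abs_nonneg (b : ℝ)]
    have h3 : (1 + sD) * Xr ≤ (1 + sD) * Xr * q := by
      have : 0 ≤ (1 + sD) * Xr := by positivity
      exact le_mul_of_one_le_right this hq1
    linarith only [h1, h2, h3]
  have hR1 : 1 ≤ (1 + sD) * Xr :=
    one_le_mul_of_one_le_of_one_le (by linarith only [hsD0]) hX1
  have hμβ' : ‖μ.eval (β' : ℂ)‖ ≤ Gs * ((1 + sD) * Xr) ^ K := by
    rw [hμeval, hGsdef, Finset.sum_mul]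
    refine (norm_sum_le _ _).trans (Finset.sum_le_sum fun k _ => ?_)
    rw [norm_mul, norm_pow, Complex.norm_real, Real.norm_eq_abs]
    refine mul_le_mul_of_nonneg_left ?_ (norm_nonneg _)
    calc |β'| ^ (k : ℕ) ≤ ((1 + sD) * Xr) ^ (k : ℕ) := pow_le_pow_left₀ (abs_nonneg _) hβ'le _
      _ ≤ ((1 + sD) * Xr) ^ K := pow_le_pow_right₀ hR1 (Nat.lt_succ_iff.mp k.2)
  have hup : ‖MvPolynomial.aeval θ P‖ ≤ c₂ * Xr ^ e₂ * ε := by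
    rw [hPe, norm_mul, norm_mul, norm_mul, norm_pow, Complex.norm_natCast]
    calc (q : ℝ) ^ K * ‖μ.eval (β : ℂ)‖ * ((q : ℝ) ^ K * ‖μ.eval (β' : ℂ)‖)
        ≤ Xr ^ K * (L * ε) * (Xr ^ K * (Gs * ((1 + sD) * Xr) ^ K)) := by
          gcongr
      _ = c₂ * Xr ^ e₂ * ε := by rw [hc₂def, he₂, mul_pow]; ring
  -- (5) lower bound from the measure: length of P
  have hdegP : P.totalDegree ≤ Dg + Dg := by
    rw [hPdef]
    refine (MvPolynomial.totalDegree_sub _ _).trans (max_le ?_ ?_)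
    · exact (MvPolynomial.totalDegree_mul _ _).trans (add_le_add
        (totalDegree_mvcombo_le α G hDg) (totalDegree_mvcombo_le α G hDg))
    · refine (MvPolynomial.totalDegree_mul _ _).trans ?_
      rw [MvPolynomial.totalDegree_C, zero_add]
      exact (MvPolynomial.totalDegree_mul _ _).trans (add_le_add
        (totalDegree_mvcombo_le γ G hDg) (totalDegree_mvcombo_le γ G hDg))
  set cc : Fin (K + 1) × Fin (K + 1) → ℤ :=
    fun jk => α jk.1 * α jk.2 - (D : ℤ) * (γ jk.1 * γ jk.2) with hccdef
  have hPcombo : P = mvcombo cc GG := by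
    rw [hPdef, h𝒜def, hℬdef, mvcombo_mul_mvcombo, mvcombo_mul_mvcombo, C_mul_mvcombo,
      mvcombo_sub_mvcombo]
  -- coefficient bounds
  set B₁ : ℝ := E ^ K * Xr ^ (2 * K) with hB₁def
  have hB₁0 : 0 ≤ B₁ := by positivity
  have hEX1 : 1 ≤ E * Xr := one_le_mul_of_one_le_of_one_le hE1 hX1
  have hqpowle : ∀ k : Fin (K + 1), ((q : ℝ)) ^ (K - k) ≤ Xr ^ K := by
    intro k
    calc (q : ℝ) ^ (K - k) ≤ Xr ^ (K - k) := pow_le_pow_left₀ hqpos.le hqX _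
      _ ≤ Xr ^ K := pow_le_pow_right₀ hX1 (Nat.sub_le K k)
  have hbase_le : ∀ k : Fin (K + 1),
      ((1 + (D : ℝ)) * (1 + |(a : ℝ)| + |(b : ℝ)|)) ^ (k : ℕ) ≤ (E * Xr) ^ K := by
    intro k
    calc ((1 + (D : ℝ)) * (1 + |(a : ℝ)| + |(b : ℝ)|)) ^ (k : ℕ) ≤ (E * Xr) ^ (k : ℕ) := by
          apply pow_le_pow_left₀ (by positivity)
          rw [hEdef]; exact mul_le_mul_of_nonneg_left habX (by linarith only [hD0])
      _ ≤ (E * Xr) ^ K := pow_le_pow_right₀ hEX1 (Nat.lt_succ_iff.mp k.2)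
  have hαle : ∀ k, |((α k : ℤ) : ℝ)| ≤ B₁ := by
    intro k
    have h1 := (qpow_abs_le D a b k).1
    simp only [hαdef, Int.cast_mul, Int.cast_pow, Int.cast_natCast, abs_mul, abs_pow,
      abs_of_pos hqpos]
    calc |(((qpow (D : ℤ) a b k).1 : ℤ) : ℝ)| * (q : ℝ) ^ (K - k) ≤ (E * Xr) ^ K * Xr ^ K :=
          mul_le_mul (h1.trans (hbase_le k)) (hqpowle k) (by positivity) (by positivity)
      _ = B₁ := by rw [hB₁def, mul_pow]; ring
  have hγle : ∀ k, |((γ k : ℤ) : ℝ)| ≤ B₁ := by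
    intro k
    have h1 := (qpow_abs_le D a b k).2
    simp only [hγdef, Int.cast_mul, Int.cast_pow, Int.cast_natCast, abs_mul, abs_pow,
      abs_of_pos hqpos]
    calc |(((qpow (D : ℤ) a b k).2 : ℤ) : ℝ)| * (q : ℝ) ^ (K - k) ≤ (E * Xr) ^ K * Xr ^ K :=
          mul_le_mul (h1.trans (hbase_le k)) (hqpowle k) (by positivity) (by positivity)
      _ = B₁ := by rw [hB₁def, mul_pow]; ring
  set Bc : ℝ := E ^ (2 * K + 1) * Xr ^ (4 * K) with hBcdef
  have hBcE : Bc = E * (B₁ * B₁) := by rw [hBcdef, hB₁def]; ring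
  have hccle : ∀ jk, |((cc jk : ℤ) : ℝ)| ≤ Bc := by
    intro jk
    simp only [hccdef, Int.cast_sub, Int.cast_mul, Int.cast_natCast]
    calc |((α jk.1 : ℤ) : ℝ) * ((α jk.2 : ℤ) : ℝ) - (D : ℝ) * (((γ jk.1 : ℤ) : ℝ) * ((γ jk.2 : ℤ) : ℝ))|
        ≤ |((α jk.1 : ℤ) : ℝ) * ((α jk.2 : ℤ) : ℝ)| + |(D : ℝ) * (((γ jk.1 : ℤ) : ℝ) * ((γ jk.2 : ℤ) : ℝ))| :=
          abs_sub _ _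
      _ = |((α jk.1 : ℤ) : ℝ)| * |((α jk.2 : ℤ) : ℝ)| +
            (D : ℝ) * (|((γ jk.1 : ℤ) : ℝ)| * |((γ jk.2 : ℤ) : ℝ)|) := by
          rw [abs_mul, abs_mul, abs_mul, abs_of_nonneg hD0]
      _ ≤ B₁ * B₁ + (D : ℝ) * (B₁ * B₁) :=
          add_le_add (mul_le_mul (hαle _) (hαle _) (abs_nonneg _) hB₁0)
            (mul_le_mul_of_nonneg_left (mul_le_mul (hγle _) (hγle _) (abs_nonneg _) hB₁0) hD0)
      _ = Bc := by rw [hBcE, hEdef]; ring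
  have hlenP : ((mvlen P : ℤ) : ℝ) ≤ Bc * ((Λ₂ : ℤ) : ℝ) := by
    have h1 : ((mvlen P : ℤ) : ℝ) ≤ ((∑ jk, |cc jk| * mvlen (GG jk) : ℤ) : ℝ) := by
      rw [hPcombo]; exact_mod_cast mvlen_mvcombo_le cc GG
    refine h1.trans ?_
    rw [hΛ₂def]
    push_cast
    rw [Finset.mul_sum]
    refine Finset.sum_le_sum fun jk _ => ?_
    exact mul_le_mul_of_nonneg_right (hccle jk) (by exact_mod_cast mvlen_nonneg _)
  have hlen0 : (0 : ℝ) ≤ ((mvlen P : ℤ) : ℝ) := by exact_mod_cast mvlen_nonneg P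
  have hlow : Real.exp (-(Cm * ((mvlen P : ℤ) : ℝ) ^ kk)) ≤ ‖MvPolynomial.aeval θ P‖ :=
    hmeas P hP0 hdegP
  have hc₁X : Cm * ((mvlen P : ℤ) : ℝ) ^ kk ≤ c₁ * Xr ^ e₁ := by
    have h1 : ((mvlen P : ℤ) : ℝ) ^ kk ≤ (Bc * ((Λ₂ : ℤ) : ℝ)) ^ kk :=
      pow_le_pow_left₀ hlen0 hlenP kk
    have h2 : (Bc * ((Λ₂ : ℤ) : ℝ)) ^ kk = (E ^ (2 * K + 1) * ((Λ₂ : ℤ) : ℝ)) ^ kk * Xr ^ e₁ := by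
      rw [hBcdef, he₁, pow_mul Xr (4 * K) kk, mul_pow, mul_pow, mul_pow]; ring
    calc Cm * ((mvlen P : ℤ) : ℝ) ^ kk ≤ Cm * (Bc * ((Λ₂ : ℤ) : ℝ)) ^ kk :=
          mul_le_mul_of_nonneg_left h1 hCm.le
      _ = c₁ * Xr ^ e₁ := by rw [h2, hc₁def]; ring
  have hlow' : Real.exp (-(c₁ * Xr ^ e₁)) ≤ ‖MvPolynomial.aeval θ P‖ :=
    (Real.exp_le_exp.mpr (neg_le_neg hc₁X)).trans hlow
  -- (6) the clash
  have hchain : Real.exp (-(c₁ * Xr ^ e₁)) ≤ c₂ * Xr ^ e₂ * ε := hlow'.trans hup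
  have hmain : c₁ * Xr ^ e₁ + c₂ * Xr ^ e₂ ≤ Xr ^ m := by
    rw [hXm]
    have h1 : c₁ * Xr ^ e₁ ≤ c₁ * (Xr ^ e₁ * Xr ^ e₂) := by
      apply mul_le_mul_of_nonneg_left _ hc₁
      calc Xr ^ e₁ = Xr ^ e₁ * 1 := (mul_one _).symm
        _ ≤ Xr ^ e₁ * Xr ^ e₂ := by gcongr; exact hXe _
    have h2 : c₂ * Xr ^ e₂ ≤ c₂ * (Xr ^ e₁ * Xr ^ e₂) := by
      apply mul_le_mul_of_nonneg_left _ hc₂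
      calc Xr ^ e₂ = 1 * Xr ^ e₂ := (one_mul _).symm
        _ ≤ Xr ^ e₁ * Xr ^ e₂ := by gcongr; exact hXe _
    have h3 : c₁ + c₂ ≤ Xr ^ N := by linarith only [hNgt, hXN, hδinv]
    calc c₁ * Xr ^ e₁ + c₂ * Xr ^ e₂
        ≤ c₁ * (Xr ^ e₁ * Xr ^ e₂) + c₂ * (Xr ^ e₁ * Xr ^ e₂) := add_le_add h1 h2
      _ = (c₁ + c₂) * (Xr ^ e₁ * Xr ^ e₂) := by ring
      _ ≤ Xr ^ N * (Xr ^ e₁ * Xr ^ e₂) := mul_le_mul_of_nonneg_right h3 (by positivity)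
      _ = Xr ^ N * Xr ^ e₁ * Xr ^ e₂ := by ring
  have hlt2 : c₂ * Xr ^ e₂ * ε < Real.exp (-(c₁ * Xr ^ e₁)) := by
    have h1 : c₂ * Xr ^ e₂ < Real.exp (Xr ^ m - c₁ * Xr ^ e₁) := by
      have h2 := Real.add_one_le_exp (Xr ^ m - c₁ * Xr ^ e₁)
      linarith only [h2, hmain]
    have h3 : Real.exp (Xr ^ m - c₁ * Xr ^ e₁) * ε = Real.exp (-(c₁ * Xr ^ e₁)) := by
      rw [hεdef, ← Real.exp_add]; congr 1; ring
    calc c₂ * Xr ^ e₂ * ε < Real.exp (Xr ^ m - c₁ * Xr ^ e₁) * ε :=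
          mul_lt_mul_of_pos_right h1 hε0
      _ = Real.exp (-(c₁ * Xr ^ e₁)) := h3
  exact absurd hchain (not_le.mpr hlt2)

end HyperCell

end Summit.Schanuel.Schanuel.Theorems.RootDecomp1KHyper
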